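import Literature.NumberTheory.Transcendental.SemialgebraicRpow
import Literature.NumberTheory.Transcendental.SemialgebraicMapsProofs
import Literature.NumberTheory.Transcendental.KZSemialgebraicComplex
import Literature.NumberTheory.Transcendental.EllIterRep
import Literature.NumberTheory.Transcendental.KZCalculusProofs

/-!
# `CompleteModGammaSector` (stmt-KontsevichZagierPeriods-14233), line `cusp-transport-to-the-beta-world`:
# stub `stub_elliottSemialgebraic` — ℚ-semialgebraicity of the Elliott family, its potentials and their derivatives

Support file (`--supports stmt-KontsevichZagierPeriods-14233`) for the registered stub `stub_elliottSemialgebraic` of the line lead's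
skeleton `Cruxes/CompleteModGammaSector/Lines/cusp-transport-to-the-beta-world.lean`. Notation (functions of
`z : Fin 3 → ℝ`, `t = z 0`, `u = z 1`, `s = z 2`; rational `0 < a < 1`, `1 - a < c`; real algebraic modulus
`z₁ ∈ (0,1)`): family `F = t^{-a}(1-t)^{c+a-2}(1-st)^{-a} · u^{-a}(1-u)^{c+a-2}(1-(1-s)u)^{-a} · (1 - st - (1-s)u)`
(Elliott–Legendre combination in Euler form, AQVV 2000 Cor. 3.13 (5); `a = 1/2`, `c = 1` is Legendre's relation),
potentials `P = t^{1-a}(1-t)^{c+a-1}(1-st)^{-a} · u^{1-a}(1-u)^{c+a-2}(1-(1-s)u)^{-a}`,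
`Q = -t^{1-a}(1-t)^{c+a-2}(1-st)^{-a} · u^{1-a}(1-u)^{c+a-1}(1-(1-s)u)^{-a}`, certificate `∂_sF = ∂_tP + ∂_uQ`.

References: M. Kontsevich, D. Zagier, *Periods* (2001), §1.2; G. D. Anderson, S.-L. Qiu, M. K. Vamanamurthy,
M. Vuorinen, *Generalized elliptic integrals and modular equations*, Pacific J. Math. 192 (2000), Cor. 3.13 (5);
G. E. Andrews, R. Askey, R. Roy, *Special Functions* (1999), Thm 3.2.8.
-/

noncomputable section

-- `Summit.KontsevichZagierPeriods.KontsevichZagierPeriods.…` is the tree's mandated layout (single-conjunct summit).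
set_option linter.dupNamespace false

namespace Summit.KontsevichZagierPeriods.KontsevichZagierPeriods.CompleteModGammaSectorCuspLine

open MeasureTheory Set
open Literature.NumberTheory.Transcendental
open Literature.ModelTheory.ExponentialFields (IsSemialgebraic)
open MvPolynomial (aeval X C)

/-! ## Toolbox: polynomial factors, rational powers, the four parameter bands -/

/-- Polynomial functions with rational coefficients (in closed form `g`) are `ℚ`-semialgebraic on
any `ℚ`-semialgebraic set. [cite: BochnakCosteRoy1998, §2.2] -/
private theorem sa_poly {s : Set (Fin 3 → ℝ)} (hs : IsSemialgebraic ℚ s)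
    (p : MvPolynomial (Fin 3) ℚ) {g : (Fin 3 → ℝ) → ℝ} (hg : ∀ z, aeval z p = g z) :
    IsSemialgebraicFunOn ℚ s g :=
  (isSemialgebraicFunOn_aeval hs p).congr fun z _ => hg z

/-- Products of `ℚ`-semialgebraic functions (lambda form).
[cite: BochnakCosteRoy1998, Prop. 2.2.6] -/
private theorem sa_mul {s : Set (Fin 3 → ℝ)} {f g : (Fin 3 → ℝ) → ℝ}
    (hf : IsSemialgebraicFunOn ℚ s f) (hg : IsSemialgebraicFunOn ℚ s g) :
    IsSemialgebraicFunOn ℚ s (fun z => f z * g z) :=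
  (IsSemialgebraicFunOn.mul_holds hf hg).congr fun _ _ => rfl

/-- Negatives of `ℚ`-semialgebraic functions (lambda form).
[cite: BochnakCosteRoy1998, Prop. 2.2.6] -/
private theorem sa_neg {s : Set (Fin 3 → ℝ)} {f : (Fin 3 → ℝ) → ℝ}
    (hf : IsSemialgebraicFunOn ℚ s f) : IsSemialgebraicFunOn ℚ s (fun z => -f z) :=
  hf.neg.congr fun _ _ => rfl

/-- Rational powers (exponent `r = e ∈ ℚ`) of positive `ℚ`-semialgebraic functions.
[cite: BochnakCosteRoy1998, Prop. 2.2.6] -/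
private theorem sa_rpow {s : Set (Fin 3 → ℝ)} (hs : IsSemialgebraic ℚ s) {g : (Fin 3 → ℝ) → ℝ}
    (hg : IsSemialgebraicFunOn ℚ s g) (hpos : ∀ z ∈ s, 0 < g z) (e : ℚ) {r : ℝ}
    (hr : (e : ℝ) = r) : IsSemialgebraicFunOn ℚ s (fun z => g z ^ r) := by
  subst hr
  exact hg.rpow_ratCast hs hpos e

/-- Rational powers with non-zero exponent `r = e ∈ ℚ` of non-negative `ℚ`-semialgebraic
functions. [cite: BochnakCosteRoy1998, Prop. 2.2.6] -/
private theorem sa_rpow_nonneg {s : Set (Fin 3 → ℝ)} {g : (Fin 3 → ℝ) → ℝ}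
    (hg : IsSemialgebraicFunOn ℚ s g) (hnn : ∀ z ∈ s, 0 ≤ g z) {e : ℚ} (he : e ≠ 0) {r : ℝ}
    (hr : (e : ℝ) = r) : IsSemialgebraicFunOn ℚ s (fun z => g z ^ r) := by
  subst hr
  exact hg.rpow_ratCast_of_nonneg hnn he

/-- Coordinate functions are `ℚ`-semialgebraic. [cite: BochnakCosteRoy1998, §2.2] -/
private theorem sa_coord {s : Set (Fin 3 → ℝ)} (hs : IsSemialgebraic ℚ s) (i : Fin 3) :
    IsSemialgebraicFunOn ℚ s (fun z => z i) :=
  sa_poly hs (X i) fun z => by simp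

/-- `z ↦ 1 - z i` is `ℚ`-semialgebraic. [cite: BochnakCosteRoy1998, §2.2] -/
private theorem sa_one_sub_coord {s : Set (Fin 3 → ℝ)} (hs : IsSemialgebraic ℚ s) (i : Fin 3) :
    IsSemialgebraicFunOn ℚ s (fun z => 1 - z i) :=
  sa_poly hs (1 - X i) fun z => by simp

/-- `z ↦ 1 - z 2 * z 0` (that is, `1 - s t`) is `ℚ`-semialgebraic.
[cite: BochnakCosteRoy1998, §2.2] -/
private theorem sa_one_sub_st {s : Set (Fin 3 → ℝ)} (hs : IsSemialgebraic ℚ s) :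
    IsSemialgebraicFunOn ℚ s (fun z => 1 - z 2 * z 0) :=
  sa_poly hs (1 - X 2 * X 0) fun z => by simp

/-- `z ↦ 1 - (1 - z 2) * z 1` (that is, `1 - (1 - s) u`) is `ℚ`-semialgebraic.
[cite: BochnakCosteRoy1998, §2.2] -/
private theorem sa_one_sub_su {s : Set (Fin 3 → ℝ)} (hs : IsSemialgebraic ℚ s) :
    IsSemialgebraicFunOn ℚ s (fun z => 1 - (1 - z 2) * z 1) :=
  sa_poly hs (1 - (1 - X 2) * X 1) fun z => by simp

/-- `z ↦ 1 - z 2 * z 0 - (1 - z 2) * z 1` (the Elliott–Legendre linear form `1 - s t - (1 - s) u`)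
is `ℚ`-semialgebraic. [cite: BochnakCosteRoy1998, §2.2] -/
private theorem sa_lin {s : Set (Fin 3 → ℝ)} (hs : IsSemialgebraic ℚ s) :
    IsSemialgebraicFunOn ℚ s (fun z => 1 - z 2 * z 0 - (1 - z 2) * z 1) :=
  sa_poly hs (1 - X 2 * X 0 - (1 - X 2) * X 1) fun z => by simp

/-- The bracket polynomial of `∂_t P` is `ℚ`-semialgebraic (rational coefficients).
[cite: BochnakCosteRoy1998, §2.2] -/
private theorem sa_bracketT {s : Set (Fin 3 → ℝ)} (hs : IsSemialgebraic ℚ s) (a c : ℚ) :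
    IsSemialgebraicFunOn ℚ s (fun z => (1 - (a : ℝ)) * (1 - z 0) * (1 - z 2 * z 0) -
      ((c : ℝ) + (a : ℝ) - 1) * z 0 * (1 - z 2 * z 0) + (a : ℝ) * z 2 * z 0 * (1 - z 0)) :=
  sa_poly hs (C (1 - a) * (1 - X 0) * (1 - X 2 * X 0) - C (c + a - 1) * X 0 * (1 - X 2 * X 0) +
      C a * X 2 * X 0 * (1 - X 0))
    fun z => by simp

/-- The bracket polynomial of `∂_u Q` is `ℚ`-semialgebraic (rational coefficients).
[cite: BochnakCosteRoy1998, §2.2] -/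
private theorem sa_bracketU {s : Set (Fin 3 → ℝ)} (hs : IsSemialgebraic ℚ s) (a c : ℚ) :
    IsSemialgebraicFunOn ℚ s (fun z => (1 - (a : ℝ)) * (1 - z 1) * (1 - (1 - z 2) * z 1) -
      ((c : ℝ) + (a : ℝ) - 1) * z 1 * (1 - (1 - z 2) * z 1) +
      (a : ℝ) * (1 - z 2) * z 1 * (1 - z 1)) :=
  sa_poly hs (C (1 - a) * (1 - X 1) * (1 - (1 - X 2) * X 1) -
      C (c + a - 1) * X 1 * (1 - (1 - X 2) * X 1) + C a * (1 - X 2) * X 1 * (1 - X 1))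
    fun z => by simp

/-- `{z | z i ∈ (lo, hi)}` is `ℚ`-semialgebraic for real algebraic `lo`, `hi`. [folklore] -/
private theorem sa_Ioo (i : Fin 3) {lo hi : ℝ} (hlo : IsAlgebraic ℚ lo) (hhi : IsAlgebraic ℚ hi) :
    IsSemialgebraic ℚ {z : Fin 3 → ℝ | z i ∈ Ioo lo hi} :=
  (KZ.isSemialgebraic_setOf_const_lt_apply hlo i).inter
    (KZ.isSemialgebraic_setOf_apply_lt_const hhi i)

/-- `{z | z i ∈ [lo, hi]}` is `ℚ`-semialgebraic for real algebraic `lo`, `hi`. [folklore] -/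
private theorem sa_Icc (i : Fin 3) {lo hi : ℝ} (hlo : IsAlgebraic ℚ lo) (hhi : IsAlgebraic ℚ hi) :
    IsSemialgebraic ℚ {z : Fin 3 → ℝ | z i ∈ Icc lo hi} := by
  convert ((KZ.isSemialgebraic_setOf_apply_lt_const hlo i).union
    (KZ.isSemialgebraic_setOf_const_lt_apply hhi i)).compl using 1
  ext z
  simp [not_lt]

/-- The `s`-closed band `(0,1)² × [0,z₁]` is `ℚ`-semialgebraic. [folklore] -/
private theorem sa_band {z₁ : ℝ} (hz₁ : IsAlgebraic ℚ z₁) :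
    IsSemialgebraic ℚ {z : Fin 3 → ℝ | (∀ i : Fin 2, z (Fin.castSucc i) ∈ Set.Ioo (0:ℝ) 1) ∧
      z (Fin.last 2) ∈ Set.Icc (0:ℝ) z₁} := by
  convert ((sa_Ioo 0 isAlgebraic_zero isAlgebraic_one).inter
    (sa_Ioo 1 isAlgebraic_zero isAlgebraic_one)).inter (sa_Icc 2 isAlgebraic_zero hz₁) using 1
  ext z
  simp only [mem_setOf_eq, mem_inter_iff, Fin.forall_fin_two]
  exact Iff.rfl

/-- The band closed in `t`: `[0,1] × (0,1) × (0,z₁)` is `ℚ`-semialgebraic. [folklore] -/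
private theorem sa_bandT {z₁ : ℝ} (hz₁ : IsAlgebraic ℚ z₁) :
    IsSemialgebraic ℚ {z : Fin 3 → ℝ |
      (∀ j : Fin 2, j ≠ 0 → z (Fin.castSucc j) ∈ Set.Ioo (0:ℝ) 1) ∧
      z (Fin.castSucc (0 : Fin 2)) ∈ Set.Icc (0:ℝ) 1 ∧ z (Fin.last 2) ∈ Set.Ioo (0:ℝ) z₁} := by
  convert (sa_Ioo 1 isAlgebraic_zero isAlgebraic_one).inter
    ((sa_Icc 0 isAlgebraic_zero isAlgebraic_one).inter (sa_Ioo 2 isAlgebraic_zero hz₁)) using 1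
  ext z
  simp only [mem_setOf_eq, mem_inter_iff, Fin.forall_fin_two]
  simp

/-- The band closed in `u`: `(0,1) × [0,1] × (0,z₁)` is `ℚ`-semialgebraic. [folklore] -/
private theorem sa_bandU {z₁ : ℝ} (hz₁ : IsAlgebraic ℚ z₁) :
    IsSemialgebraic ℚ {z : Fin 3 → ℝ |
      (∀ j : Fin 2, j ≠ 1 → z (Fin.castSucc j) ∈ Set.Ioo (0:ℝ) 1) ∧
      z (Fin.castSucc (1 : Fin 2)) ∈ Set.Icc (0:ℝ) 1 ∧ z (Fin.last 2) ∈ Set.Ioo (0:ℝ) z₁} := by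
  convert (sa_Ioo 0 isAlgebraic_zero isAlgebraic_one).inter
    ((sa_Icc 1 isAlgebraic_zero isAlgebraic_one).inter (sa_Ioo 2 isAlgebraic_zero hz₁)) using 1
  ext z
  simp only [mem_setOf_eq, mem_inter_iff, Fin.forall_fin_two]
  simp

/-- The open band `(0,1)² × (0,z₁)` is `ℚ`-semialgebraic. [folklore] -/
private theorem sa_openBand {z₁ : ℝ} (hz₁ : IsAlgebraic ℚ z₁) :
    IsSemialgebraic ℚ {z : Fin 3 → ℝ | (∀ j : Fin 2, z (Fin.castSucc j) ∈ Set.Ioo (0:ℝ) 1) ∧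
      z (Fin.last 2) ∈ Set.Ioo (0:ℝ) z₁} := by
  convert ((sa_Ioo 0 isAlgebraic_zero isAlgebraic_one).inter
    (sa_Ioo 1 isAlgebraic_zero isAlgebraic_one)).inter (sa_Ioo 2 isAlgebraic_zero hz₁) using 1
  ext z
  simp only [mem_setOf_eq, mem_inter_iff, Fin.forall_fin_two]
  exact Iff.rfl

/-- `0 < 1 - σ τ` for `0 ≤ σ < 1` and `τ ≤ 1`. [folklore] -/
private theorem one_sub_mul_pos {σ τ : ℝ} (hσ0 : 0 ≤ σ) (hσ1 : σ < 1) (hτ1 : τ ≤ 1) :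
    0 < 1 - σ * τ := by
  nlinarith

/-- `0 < 1 - (1 - σ) υ` for `0 ≤ σ < 1`, `0 ≤ υ ≤ 1` and (`υ < 1` or `0 < σ`). [folklore] -/
private theorem one_sub_one_sub_mul_pos {σ υ : ℝ} (hσ0 : 0 ≤ σ) (hσ1 : σ < 1) (hυ0 : 0 ≤ υ)
    (hυ1 : υ ≤ 1) (h : υ < 1 ∨ 0 < σ) : 0 < 1 - (1 - σ) * υ := by
  rcases h with h | h <;> nlinarith

/-! ## The stub -/

/-- Stub `stub_elliottSemialgebraic` of line `cusp-transport-to-the-beta-world` (ℚ-semialgebraicity of the Elliott family, its potentials and their derivatives). [cite: KontsevichZagier2001, §1.2] -/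
theorem stub_elliottSemialgebraic : ∀ (a c : ℚ) (z₁ : ℝ), 0 < a → a < 1 → 1 - a < c → 0 < z₁ → z₁ < 1 → IsAlgebraic ℚ z₁ →
    IsSemialgebraicFunOn ℚ {z : Fin 3 → ℝ | (∀ i : Fin 2, z (Fin.castSucc i) ∈ Set.Ioo (0:ℝ) 1) ∧ z (Fin.last 2) ∈ Set.Icc (0:ℝ) z₁}
      (fun z => (z 0) ^ (-(a : ℝ)) * (1 - z 0) ^ ((c : ℝ) + (a : ℝ) - 2) * (1 - z 2 * z 0) ^ (-(a : ℝ)) * ((z 1) ^ (-(a : ℝ)) * (1 - z 1) ^ ((c : ℝ) + (a : ℝ) - 2) * (1 - (1 - z 2) * z 1) ^ (-(a : ℝ))) * (1 - z 2 * z 0 - (1 - z 2) * z 1)) ∧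
    IsSemialgebraicFunOn ℚ {z : Fin 3 → ℝ | (∀ j : Fin 2, j ≠ 0 → z (Fin.castSucc j) ∈ Set.Ioo (0:ℝ) 1) ∧ z (Fin.castSucc (0 : Fin 2)) ∈ Set.Icc (0:ℝ) 1 ∧ z (Fin.last 2) ∈ Set.Ioo (0:ℝ) z₁}
      (fun z => (z 0) ^ (1 - (a : ℝ)) * (1 - z 0) ^ ((c : ℝ) + (a : ℝ) - 1) * (1 - z 2 * z 0) ^ (-(a : ℝ)) * ((z 1) ^ (1 - (a : ℝ)) * (1 - z 1) ^ ((c : ℝ) + (a : ℝ) - 2) * (1 - (1 - z 2) * z 1) ^ (-(a : ℝ)))) ∧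
    IsSemialgebraicFunOn ℚ {z : Fin 3 → ℝ | (∀ j : Fin 2, j ≠ 1 → z (Fin.castSucc j) ∈ Set.Ioo (0:ℝ) 1) ∧ z (Fin.castSucc (1 : Fin 2)) ∈ Set.Icc (0:ℝ) 1 ∧ z (Fin.last 2) ∈ Set.Ioo (0:ℝ) z₁}
      (fun z => -((z 0) ^ (1 - (a : ℝ)) * (1 - z 0) ^ ((c : ℝ) + (a : ℝ) - 2) * (1 - z 2 * z 0) ^ (-(a : ℝ)) * ((z 1) ^ (1 - (a : ℝ)) * (1 - z 1) ^ ((c : ℝ) + (a : ℝ) - 1) * (1 - (1 - z 2) * z 1) ^ (-(a : ℝ))))) ∧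
    IsSemialgebraicFunOn ℚ {z : Fin 3 → ℝ | (∀ j : Fin 2, z (Fin.castSucc j) ∈ Set.Ioo (0:ℝ) 1) ∧ z (Fin.last 2) ∈ Set.Ioo (0:ℝ) z₁}
      (fun z => (z 0) ^ (-(a : ℝ)) * (1 - z 0) ^ ((c : ℝ) + (a : ℝ) - 2) * (1 - z 2 * z 0) ^ (-(a : ℝ) - 1) * ((1 - (a : ℝ)) * (1 - z 0) * (1 - z 2 * z 0) - ((c : ℝ) + (a : ℝ) - 1) * z 0 * (1 - z 2 * z 0) + (a : ℝ) * z 2 * z 0 * (1 - z 0)) * ((z 1) ^ (1 - (a : ℝ)) * (1 - z 1) ^ ((c : ℝ) + (a : ℝ) - 2) * (1 - (1 - z 2) * z 1) ^ (-(a : ℝ)))) ∧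
    IsSemialgebraicFunOn ℚ {z : Fin 3 → ℝ | (∀ j : Fin 2, z (Fin.castSucc j) ∈ Set.Ioo (0:ℝ) 1) ∧ z (Fin.last 2) ∈ Set.Ioo (0:ℝ) z₁}
      (fun z => -((z 0) ^ (1 - (a : ℝ)) * (1 - z 0) ^ ((c : ℝ) + (a : ℝ) - 2) * (1 - z 2 * z 0) ^ (-(a : ℝ)) * ((z 1) ^ (-(a : ℝ)) * (1 - z 1) ^ ((c : ℝ) + (a : ℝ) - 2) * (1 - (1 - z 2) * z 1) ^ (-(a : ℝ) - 1) * ((1 - (a : ℝ)) * (1 - z 1) * (1 - (1 - z 2) * z 1) - ((c : ℝ) + (a : ℝ) - 1) * z 1 * (1 - (1 - z 2) * z 1) + (a : ℝ) * (1 - z 2) * z 1 * (1 - z 1))))) := by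
  intro a c z₁ _ha0 ha1 hac _hz0 hz1 hz₁
  -- exponent bookkeeping: every exponent is a rational number cast to `ℝ`
  have e_na : ((-a : ℚ) : ℝ) = -(a : ℝ) := by push_cast; ring
  have e_ca2 : ((c + a - 2 : ℚ) : ℝ) = (c : ℝ) + (a : ℝ) - 2 := by push_cast; ring
  have e_1a : ((1 - a : ℚ) : ℝ) = 1 - (a : ℝ) := by push_cast; ring
  have e_ca1 : ((c + a - 1 : ℚ) : ℝ) = (c : ℝ) + (a : ℝ) - 1 := by push_cast; ring
  have e_na1 : ((-a - 1 : ℚ) : ℝ) = -(a : ℝ) - 1 := by push_cast; ring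
  have h1a : (1 - a : ℚ) ≠ 0 := (sub_pos.mpr ha1).ne'
  have hca1 : (c + a - 1 : ℚ) ≠ 0 := by
    have h : (0 : ℚ) < c + a - 1 := by linarith
    exact h.ne'
  -- the four `ℚ`-semialgebraic parameter sets
  have hB := sa_band hz₁
  have hT := sa_bandT hz₁
  have hU := sa_bandU hz₁
  have hO := sa_openBand hz₁
  refine ⟨?_, ?_, ?_, ?_, ?_⟩
  · -- (1) the family `F` on the `s`-closed band `t, u ∈ (0,1)`, `s ∈ [0,z₁]`
    have hb : ∀ z ∈ {z : Fin 3 → ℝ | (∀ i : Fin 2, z (Fin.castSucc i) ∈ Set.Ioo (0:ℝ) 1) ∧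
        z (Fin.last 2) ∈ Set.Icc (0:ℝ) z₁},
        0 < z 0 ∧ z 0 < 1 ∧ 0 < z 1 ∧ z 1 < 1 ∧ 0 ≤ z 2 ∧ z 2 < 1 := fun z hz =>
      ⟨(hz.1 0).1, (hz.1 0).2, (hz.1 1).1, (hz.1 1).2, hz.2.1, hz.2.2.trans_lt hz1⟩
    refine sa_mul (sa_mul (sa_mul (sa_mul ?_ ?_) ?_) (sa_mul (sa_mul ?_ ?_) ?_)) (sa_lin hB)
    · exact sa_rpow hB (sa_coord hB 0) (fun z hz => (hb z hz).1) (-a) e_na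
    · exact sa_rpow hB (sa_one_sub_coord hB 0) (fun z hz => sub_pos.mpr (hb z hz).2.1)
        (c + a - 2) e_ca2
    · exact sa_rpow hB (sa_one_sub_st hB) (fun z hz => by
        obtain ⟨-, h1, -, -, h4, h5⟩ := hb z hz
        exact one_sub_mul_pos h4 h5 h1.le) (-a) e_na
    · exact sa_rpow hB (sa_coord hB 1) (fun z hz => (hb z hz).2.2.1) (-a) e_na
    · exact sa_rpow hB (sa_one_sub_coord hB 1) (fun z hz => sub_pos.mpr (hb z hz).2.2.2.1)
        (c + a - 2) e_ca2
    · exact sa_rpow hB (sa_one_sub_su hB) (fun z hz => by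
        obtain ⟨-, -, h2, h3, h4, h5⟩ := hb z hz
        exact one_sub_one_sub_mul_pos h4 h5 h2.le h3.le (Or.inl h3)) (-a) e_na
  · -- (2) the potential `P` on the band closed in `t`: `t ∈ [0,1]`, `u ∈ (0,1)`, `s ∈ (0,z₁)`
    have hb : ∀ z ∈ {z : Fin 3 → ℝ |
        (∀ j : Fin 2, j ≠ 0 → z (Fin.castSucc j) ∈ Set.Ioo (0:ℝ) 1) ∧
        z (Fin.castSucc (0 : Fin 2)) ∈ Set.Icc (0:ℝ) 1 ∧ z (Fin.last 2) ∈ Set.Ioo (0:ℝ) z₁},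
        0 ≤ z 0 ∧ z 0 ≤ 1 ∧ 0 < z 1 ∧ z 1 < 1 ∧ 0 < z 2 ∧ z 2 < 1 := fun z hz =>
      ⟨hz.2.1.1, hz.2.1.2, (hz.1 1 (by decide)).1, (hz.1 1 (by decide)).2, hz.2.2.1,
        hz.2.2.2.trans hz1⟩
    refine sa_mul (sa_mul (sa_mul ?_ ?_) ?_) (sa_mul (sa_mul ?_ ?_) ?_)
    · exact sa_rpow_nonneg (sa_coord hT 0) (fun z hz => (hb z hz).1) h1a e_1a
    · exact sa_rpow_nonneg (sa_one_sub_coord hT 0) (fun z hz => sub_nonneg.mpr (hb z hz).2.1)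
        hca1 e_ca1
    · exact sa_rpow hT (sa_one_sub_st hT) (fun z hz => by
        obtain ⟨-, h1, -, -, h4, h5⟩ := hb z hz
        exact one_sub_mul_pos h4.le h5 h1) (-a) e_na
    · exact sa_rpow hT (sa_coord hT 1) (fun z hz => (hb z hz).2.2.1) (1 - a) e_1a
    · exact sa_rpow hT (sa_one_sub_coord hT 1) (fun z hz => sub_pos.mpr (hb z hz).2.2.2.1)
        (c + a - 2) e_ca2
    · exact sa_rpow hT (sa_one_sub_su hT) (fun z hz => by
        obtain ⟨-, -, h2, h3, h4, h5⟩ := hb z hz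
        exact one_sub_one_sub_mul_pos h4.le h5 h2.le h3.le (Or.inl h3)) (-a) e_na
  · -- (3) the potential `Q` on the band closed in `u`: `t ∈ (0,1)`, `u ∈ [0,1]`, `s ∈ (0,z₁)`
    have hb : ∀ z ∈ {z : Fin 3 → ℝ |
        (∀ j : Fin 2, j ≠ 1 → z (Fin.castSucc j) ∈ Set.Ioo (0:ℝ) 1) ∧
        z (Fin.castSucc (1 : Fin 2)) ∈ Set.Icc (0:ℝ) 1 ∧ z (Fin.last 2) ∈ Set.Ioo (0:ℝ) z₁},
        0 < z 0 ∧ z 0 < 1 ∧ 0 ≤ z 1 ∧ z 1 ≤ 1 ∧ 0 < z 2 ∧ z 2 < 1 := fun z hz =>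
      ⟨(hz.1 0 (by decide)).1, (hz.1 0 (by decide)).2, hz.2.1.1, hz.2.1.2, hz.2.2.1,
        hz.2.2.2.trans hz1⟩
    refine sa_neg (sa_mul (sa_mul (sa_mul ?_ ?_) ?_) (sa_mul (sa_mul ?_ ?_) ?_))
    · exact sa_rpow hU (sa_coord hU 0) (fun z hz => (hb z hz).1) (1 - a) e_1a
    · exact sa_rpow hU (sa_one_sub_coord hU 0) (fun z hz => sub_pos.mpr (hb z hz).2.1)
        (c + a - 2) e_ca2
    · exact sa_rpow hU (sa_one_sub_st hU) (fun z hz => by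
        obtain ⟨-, h1, -, -, h4, h5⟩ := hb z hz
        exact one_sub_mul_pos h4.le h5 h1.le) (-a) e_na
    · exact sa_rpow_nonneg (sa_coord hU 1) (fun z hz => (hb z hz).2.2.1) h1a e_1a
    · exact sa_rpow_nonneg (sa_one_sub_coord hU 1)
        (fun z hz => sub_nonneg.mpr (hb z hz).2.2.2.1) hca1 e_ca1
    · exact sa_rpow hU (sa_one_sub_su hU) (fun z hz => by
        obtain ⟨-, -, h2, h3, h4, h5⟩ := hb z hz
        exact one_sub_one_sub_mul_pos h4.le h5 h2 h3 (Or.inr h4)) (-a) e_na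
  · -- (4) the derivative `∂_t P` on the open band
    have hb : ∀ z ∈ {z : Fin 3 → ℝ | (∀ j : Fin 2, z (Fin.castSucc j) ∈ Set.Ioo (0:ℝ) 1) ∧
        z (Fin.last 2) ∈ Set.Ioo (0:ℝ) z₁},
        0 < z 0 ∧ z 0 < 1 ∧ 0 < z 1 ∧ z 1 < 1 ∧ 0 < z 2 ∧ z 2 < 1 := fun z hz =>
      ⟨(hz.1 0).1, (hz.1 0).2, (hz.1 1).1, (hz.1 1).2, hz.2.1, hz.2.2.trans hz1⟩
    refine sa_mul (sa_mul (sa_mul (sa_mul ?_ ?_) ?_) (sa_bracketT hO a c))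
      (sa_mul (sa_mul ?_ ?_) ?_)
    · exact sa_rpow hO (sa_coord hO 0) (fun z hz => (hb z hz).1) (-a) e_na
    · exact sa_rpow hO (sa_one_sub_coord hO 0) (fun z hz => sub_pos.mpr (hb z hz).2.1)
        (c + a - 2) e_ca2
    · exact sa_rpow hO (sa_one_sub_st hO) (fun z hz => by
        obtain ⟨-, h1, -, -, h4, h5⟩ := hb z hz
        exact one_sub_mul_pos h4.le h5 h1.le) (-a - 1) e_na1
    · exact sa_rpow hO (sa_coord hO 1) (fun z hz => (hb z hz).2.2.1) (1 - a) e_1a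
    · exact sa_rpow hO (sa_one_sub_coord hO 1) (fun z hz => sub_pos.mpr (hb z hz).2.2.2.1)
        (c + a - 2) e_ca2
    · exact sa_rpow hO (sa_one_sub_su hO) (fun z hz => by
        obtain ⟨-, -, h2, h3, h4, h5⟩ := hb z hz
        exact one_sub_one_sub_mul_pos h4.le h5 h2.le h3.le (Or.inl h3)) (-a) e_na
  · -- (5) the derivative `∂_u Q` on the open band
    have hb : ∀ z ∈ {z : Fin 3 → ℝ | (∀ j : Fin 2, z (Fin.castSucc j) ∈ Set.Ioo (0:ℝ) 1) ∧
        z (Fin.last 2) ∈ Set.Ioo (0:ℝ) z₁},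
        0 < z 0 ∧ z 0 < 1 ∧ 0 < z 1 ∧ z 1 < 1 ∧ 0 < z 2 ∧ z 2 < 1 := fun z hz =>
      ⟨(hz.1 0).1, (hz.1 0).2, (hz.1 1).1, (hz.1 1).2, hz.2.1, hz.2.2.trans hz1⟩
    refine sa_neg (sa_mul (sa_mul (sa_mul ?_ ?_) ?_)
      (sa_mul (sa_mul (sa_mul ?_ ?_) ?_) (sa_bracketU hO a c)))
    · exact sa_rpow hO (sa_coord hO 0) (fun z hz => (hb z hz).1) (1 - a) e_1a
    · exact sa_rpow hO (sa_one_sub_coord hO 0) (fun z hz => sub_pos.mpr (hb z hz).2.1)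
        (c + a - 2) e_ca2
    · exact sa_rpow hO (sa_one_sub_st hO) (fun z hz => by
        obtain ⟨-, h1, -, -, h4, h5⟩ := hb z hz
        exact one_sub_mul_pos h4.le h5 h1.le) (-a) e_na
    · exact sa_rpow hO (sa_coord hO 1) (fun z hz => (hb z hz).2.2.1) (-a) e_na
    · exact sa_rpow hO (sa_one_sub_coord hO 1) (fun z hz => sub_pos.mpr (hb z hz).2.2.2.1)
        (c + a - 2) e_ca2
    · exact sa_rpow hO (sa_one_sub_su hO) (fun z hz => by
        obtain ⟨-, -, h2, h3, h4, h5⟩ := hb z hz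
        exact one_sub_one_sub_mul_pos h4.le h5 h2.le h3.le (Or.inl h3)) (-a - 1) e_na1

end Summit.KontsevichZagierPeriods.KontsevichZagierPeriods.CompleteModGammaSectorCuspLine
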